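import Summits.KontsevichZagierPeriods.KontsevichZagierPeriods.Theses.LiouvilleUnfolding
import Summits.KontsevichZagierPeriods.KontsevichZagierPeriods.Theorems.LiouvilleUnfoldingLogKernelConjectureSplitGlue
import Summits.KontsevichZagierPeriods.KontsevichZagierPeriods.Theorems.LiouvilleUnfoldingLogKernelConjectureCensus

/-!
# Line `spectator-localisation` — skeleton for crux `LiouvilleUnfolding.LogKernelConjecture`
(stmt-KontsevichZagierPeriods-2837), lead reshape 4 (lead c5, 2026-08-17): localise at the SINGLE
spectator `[π]`, so that the two residual stubs are — verbatim — the two EXISTING staffed items of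
route AyoubSpecialisation, exactly as the route's deciding theorem `LiouvilleUnfolding.closes` (rev 5:
`(h₁ : LogPrimitiveNL) (h₂ : LogKernelConjectureSplitGlue) (h₃ : AyoubPiLocalKernel)
(h₄ : AyoubPiCancellation)`) now reads.

History. Reshape 3 (leads c1/c2/c3, `Lines/spectator_localisation.lean` sha 437b6b9d) had the two open
stubs `stub_darkTorsion` (DT₁: the kernel is torsion for the monoid of good one-dimensional spectators)
and `stub_spectatorFibration` (SF₁: good one-dimensional spectators cancel), with the engine
(p80005 p82291 p83604 p84766), product-fibred (p86482) and the exact split (p87631) LANDED. By the tree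
theorems `LogKernelConjectureCensus.darkTorsion_and_spectatorFibration_iff_piLocalKernel_and_piCancellation`
and `SplitGlue.logKernelConjecture_iff_ayoubPiLocalKernel_and_ayoubPiCancellation` the pair
(DT₁, SF₁) is jointly equivalent to the pair (item 0541, item 0540) — and to the crux, and to the summit
`KontsevichZagierPeriods` (p95927). Shrinking the spectator monoid from "all good 1-dim spectators" to
`{[π]^N}` moves strength from the structural half to the arithmetic half (DT₁ ⟸ 0541, SF₁ ⟹ 0540) and
makes both halves coincide ON THE NOSE with filed, vetted, staffed items:

* `stub_item0541_ayoubPiLocalKernel` — the literal statement of item stmt-KontsevichZagierPeriods-0541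
  (`AyoubSpecialisation.AyoubPiLocalKernel`, = `LiouvilleUnfolding.AyoubPiLocalKernel` by `Iff.rfl`;
  ↔ `KZ.PiLocalKernel` by `KernelForm.LocaliseAtValuePrime.ayoubPiLocalKernel_iff_piLocalKernel`):
  every formal combination of value `0` becomes a relation after finitely many multiplications by a
  pinned disc product `P n r = [unit disc] ⋆ r`. OPEN (Grothendieck-period-conjecture strength).
* `stub_item0540_ayoubPiCancellation` — the literal statement of item stmt-KontsevichZagierPeriods-0540
  (`AyoubSpecialisation.AyoubPiCancellation`; ↔ `KZ.PiCancellation` by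
  `BetaCancellationLine.stub_ayoubBridge`): `P`-multiplication reflects relations (`[π]` is a
  non-zero-divisor of `FormalRep ⧸ relations`). OPEN (transcendence-free; the effective/localised seam).

DO NOT seat stub workers on these two stubs: they ARE items 0541 / 0540 (attack the items). The crux
item carries the planner hold `needs stmt-KontsevichZagierPeriods-0540`.

Composition: `LogKernelConjecture_of` below concludes the crux BY NAME through the landed glue
(item 17107, `SplitGlue.logKernelConjectureSplitGlue_proof`); sorries only in `stub_*`; the split is
exact (`stubs_iff_logKernelConjecture`), so neither stub is the crux weakened for free and a
refutation of either stub refutes the crux (`not_logKernelConjecture_of_not_stub0540/0541`).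
-/

noncomputable section

open Literature.NumberTheory.Transcendental

namespace Summit.KontsevichZagierPeriods.LiouvilleUnfolding.SpectatorLocalisation

/-! ## The two stubs = items 0541 and 0540 verbatim -/

/-- **Stub = item stmt-KontsevichZagierPeriods-0541 (`AyoubPiLocalKernel`), literal statement.**
The `π`-localised kernel conjecture: for every pinned disc-product family `P`, every formal
combination `c` of value `0` satisfies `(lift (of ∘ P))^[N] c ∈ KZ.relations` for some `N`.
OPEN — arithmetic half of the summit (Ayoub 2014, EMS Newsl. 91, Conj. 7; Kontsevich–Zagier 2001 §4.1). -/
theorem stub_item0541_ayoubPiLocalKernel :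
    ∀ (P : ∀ n : ℕ, Literature.NumberTheory.Transcendental.KZ.IntegralRep n → Literature.NumberTheory.Transcendental.KZ.IntegralRep (n + 2)), (∀ (n : ℕ) (r : Literature.NumberTheory.Transcendental.KZ.IntegralRep n), (P n r).domain = {z : Fin (n + 2) → ℝ | z 0 ^ 2 + z 1 ^ 2 ≤ 1 ∧ (fun i : Fin n => z i.succ.succ) ∈ r.domain} ∧ (P n r).integrand = fun z => r.integrand (fun i : Fin n => z i.succ.succ)) → ∀ c : Literature.NumberTheory.Transcendental.KZ.FormalRep, Literature.NumberTheory.Transcendental.KZ.eval c = 0 → ∃ N : ℕ, (⇑(FreeAbelianGroup.lift (fun s : (Σ n, Literature.NumberTheory.Transcendental.KZ.IntegralRep n) => Literature.NumberTheory.Transcendental.KZ.of (P s.1 s.2))))^[N] c ∈ Literature.NumberTheory.Transcendental.KZ.relations := by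
  sorry

/-- **Stub = item stmt-KontsevichZagierPeriods-0540 (`AyoubPiCancellation`), literal statement.**
`[π]`-cancellation: for every pinned disc-product family `P`, `lift (of ∘ P) c ∈ KZ.relations →
c ∈ KZ.relations`. OPEN — structural half of the summit, transcendence-free (Huber–Wüstholz 2022
App. A.4: injectivity of `P̃^eff → P̃` is open; Ayoub, rel. KZ revisited, Rem. 1.3). -/
theorem stub_item0540_ayoubPiCancellation :
    ∀ (P : ∀ n : ℕ, Literature.NumberTheory.Transcendental.KZ.IntegralRep n → Literature.NumberTheory.Transcendental.KZ.IntegralRep (n + 2)), (∀ (n : ℕ) (r : Literature.NumberTheory.Transcendental.KZ.IntegralRep n), (P n r).domain = {z : Fin (n + 2) → ℝ | z 0 ^ 2 + z 1 ^ 2 ≤ 1 ∧ (fun i : Fin n => z i.succ.succ) ∈ r.domain} ∧ (P n r).integrand = fun z => r.integrand (fun i : Fin n => z i.succ.succ)) → ∀ c : Literature.NumberTheory.Transcendental.KZ.FormalRep, FreeAbelianGroup.lift (fun s : (Σ n, Literature.NumberTheory.Transcendental.KZ.IntegralRep n) => Literature.NumberTheory.Transcendental.KZ.of (P s.1 s.2))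 c ∈ Literature.NumberTheory.Transcendental.KZ.relations → c ∈ Literature.NumberTheory.Transcendental.KZ.relations := by
  sorry

/-! ## Identity of the stubs with the route decls (on the nose) -/

/-- The first stub IS the route decl `LiouvilleUnfolding.AyoubPiLocalKernel` (item 0541 attached to
route LiouvilleUnfolding, rev 3) and route AyoubSpecialisation's `AyoubPiLocalKernel`: definitional. -/
theorem stub0541_iff_routeDecl :
    (∀ (P : ∀ n : ℕ, Literature.NumberTheory.Transcendental.KZ.IntegralRep n → Literature.NumberTheory.Transcendental.KZ.IntegralRep (n + 2)), (∀ (n : ℕ) (r : Literature.NumberTheory.Transcendental.KZ.IntegralRep n), (P n r).domain = {z : Fin (n + 2) → ℝ | z 0 ^ 2 + z 1 ^ 2 ≤ 1 ∧ (fun i : Fin n => z i.succ.succ) ∈ r.domain} ∧ (P n r).integrand = fun z => r.integrand (fun i : Fin n => z i.succ.succ)) → ∀ c : Literature.NumberTheory.Transcendental.KZ.FormalRep, Literature.NumberTheory.Transcendental.KZ.eval c = 0 → ∃ N : ℕ, (⇑(FreeAbelianGroup.lift (fun s : (Σ n, Literature.NumberTheory.Transcendental.KZ.IntegralRep n) =>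 Literature.NumberTheory.Transcendental.KZ.of (P s.1 s.2))))^[N] c ∈ Literature.NumberTheory.Transcendental.KZ.relations) ↔
    Summit.KontsevichZagierPeriods.KontsevichZagierPeriods.Theses.LiouvilleUnfolding.AyoubPiLocalKernel ∧
      Summit.KontsevichZagierPeriods.KontsevichZagierPeriods.Theses.AyoubSpecialisation.AyoubPiLocalKernel :=
  (and_self_iff).symm

/-- The second stub IS the route decl `LiouvilleUnfolding.AyoubPiCancellation` (item 0540 attached to
route LiouvilleUnfolding, rev 3) and route AyoubSpecialisation's `AyoubPiCancellation`: definitional. -/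
theorem stub0540_iff_routeDecl :
    (∀ (P : ∀ n : ℕ, Literature.NumberTheory.Transcendental.KZ.IntegralRep n → Literature.NumberTheory.Transcendental.KZ.IntegralRep (n + 2)), (∀ (n : ℕ) (r : Literature.NumberTheory.Transcendental.KZ.IntegralRep n), (P n r).domain = {z : Fin (n + 2) → ℝ | z 0 ^ 2 + z 1 ^ 2 ≤ 1 ∧ (fun i : Fin n => z i.succ.succ) ∈ r.domain} ∧ (P n r).integrand = fun z => r.integrand (fun i : Fin n => z i.succ.succ)) → ∀ c : Literature.NumberTheory.Transcendental.KZ.FormalRep, FreeAbelianGroup.lift (fun s : (Σ n, Literature.NumberTheory.Transcendental.KZ.IntegralRep n) => Literature.NumberTheory.Transcendental.KZ.of (P s.1 s.2)) c ∈ Literature.NumberTheory.Transcendental.KZ.relations → c ∈ Literature.NumberTheory.Transcendental.KZ.relations) ↔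
    Summit.KontsevichZagierPeriods.KontsevichZagierPeriods.Theses.LiouvilleUnfolding.AyoubPiCancellation ∧
      Summit.KontsevichZagierPeriods.KontsevichZagierPeriods.Theses.AyoubSpecialisation.AyoubPiCancellation :=
  (and_self_iff).symm

/-! ## Exactness and the negative hooks -/

/-- **Exactness of reshape 4** (tree theorem `SplitGlue.logKernelConjecture_iff_subs`, p95927 ∘ p121847):
the crux is EQUIVALENT to the conjunction of the two stubs, so the stubs are jointly the summit and
neither is banked for free. -/
theorem stubs_iff_logKernelConjecture :
    (Summit.KontsevichZagierPeriods.KontsevichZagierPeriods.Theses.AyoubSpecialisation.AyoubPiLocalKernel ∧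
      Summit.KontsevichZagierPeriods.KontsevichZagierPeriods.Theses.AyoubSpecialisation.AyoubPiCancellation) ↔
    Summit.KontsevichZagierPeriods.KontsevichZagierPeriods.Theses.LiouvilleUnfolding.LogKernelConjecture :=
  SplitGlue.logKernelConjecture_iff_ayoubPiLocalKernel_and_ayoubPiCancellation.symm

/-- Negative hook: a refutation of item 0540 (`[π]` a zero-divisor modulo the four moves) refutes the
crux outright — this is how stmt-2837 closes `refuted` the moment stmt-0540 does. -/
theorem not_logKernelConjecture_of_not_stub0540
    (h : ¬ Summit.KontsevichZagierPeriods.KontsevichZagierPeriods.Theses.AyoubSpecialisation.AyoubPiCancellation) :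
    ¬ Summit.KontsevichZagierPeriods.KontsevichZagierPeriods.Theses.LiouvilleUnfolding.LogKernelConjecture :=
  fun hK => h (SplitGlue.logKernelConjecture_iff_ayoubPiLocalKernel_and_ayoubPiCancellation.mp hK).2

/-- Negative hook: a refutation of item 0541 refutes the crux outright. -/
theorem not_logKernelConjecture_of_not_stub0541
    (h : ¬ Summit.KontsevichZagierPeriods.KontsevichZagierPeriods.Theses.AyoubSpecialisation.AyoubPiLocalKernel) :
    ¬ Summit.KontsevichZagierPeriods.KontsevichZagierPeriods.Theses.LiouvilleUnfolding.LogKernelConjecture :=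
  fun hK => h (SplitGlue.logKernelConjecture_iff_ayoubPiLocalKernel_and_ayoubPiCancellation.mp hK).1

/-- Position of reshape 4 against reshape 3 (for the record, tree theorem
`LogKernelConjectureCensus.darkTorsion_and_spectatorFibration_iff_piLocalKernel_and_piCancellation` read
through the two item dictionaries): the old pair (DT₁, SF₁) and the new pair (0541, 0540) are jointly
equivalent. -/
theorem reshape3_iff_reshape4 :
    ((∀ c : Literature.NumberTheory.Transcendental.KZ.FormalRep, Literature.NumberTheory.Transcendental.KZ.eval c = 0 → ∃ l : List (Literature.NumberTheory.Transcendental.KZ.IntegralRep 1), (∀ s ∈ l, s.value ≠ 0) ∧ List.foldr (fun s x => Literature.NumberTheory.Transcendental.KZ.of s * x) c l ∈ Literature.NumberTheory.Transcendental.KZ.relations) ∧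
      (∀ (s : Literature.NumberTheory.Transcendental.KZ.IntegralRep 1) (c : Literature.NumberTheory.Transcendental.KZ.FormalRep), s.value ≠ 0 → Literature.NumberTheory.Transcendental.KZ.of s * c ∈ Literature.NumberTheory.Transcendental.KZ.relations → ∃ c' : Literature.NumberTheory.Transcendental.KZ.FormalRep, c - c' ∈ Literature.NumberTheory.Transcendental.KZ.relations ∧ Literature.NumberTheory.Transcendental.KZ.of s * c' ∈ Literature.NumberTheory.Transcendental.KZ.fibredRelations)) ↔
    (Summit.KontsevichZagierPeriods.KontsevichZagierPeriods.Theses.AyoubSpecialisation.AyoubPiLocalKernel ∧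
      Summit.KontsevichZagierPeriods.KontsevichZagierPeriods.Theses.AyoubSpecialisation.AyoubPiCancellation) :=
  LogKernelConjectureCensus.logKernelConjecture_iff_darkTorsion_and_spectatorFibration.symm.trans
    SplitGlue.logKernelConjecture_iff_ayoubPiLocalKernel_and_ayoubPiCancellation

/-! ## The crux BY NAME -/

/-- **The crux BY NAME** from the two stubs, through the landed glue of item 17107
(`SplitGlue.logKernelConjectureSplitGlue_proof : ⟨0541⟩ → ⟨0540⟩ → LogKernelConjecture`). -/
theorem LogKernelConjecture_of :
    Summit.KontsevichZagierPeriods.KontsevichZagierPeriods.Theses.LiouvilleUnfolding.LogKernelConjecture :=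
  SplitGlue.logKernelConjecture_iff_subs.mpr
    ⟨stub_item0541_ayoubPiLocalKernel, stub_item0540_ayoubPiCancellation⟩

end Summit.KontsevichZagierPeriods.LiouvilleUnfolding.SpectatorLocalisation

end
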